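import Summits.NavierStokesRegularity.FunctionalMining.StretchingFillerPlus
import Summits.NavierStokesRegularity.FunctionalMining.StretchingWrapEnvelope
import Summits.NavierStokesRegularity.FunctionalMining.StretchingWrapIdentityAssembly
import HarnessLib

/-!
# K1-Q1: the wrap blueprint closed in the kernel — `C_{2.5D} = ½ < (2+√5)/8 ≤ C⋆`

Cell `pub-nsfunc` (host summit NavierStokesRegularity, topic `FunctionalMining`), prove seat gen 5: the kernel
endgame of the bank seat's wrap blueprint (`WRAP-KERNEL-BLUEPRINT.md`, hand Theorem 3 of `K1Q1-HALF.md`, typed by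
the dictionary seat in `StretchingWrapIdentity.lean` / `StretchingWrapIdentityAssembly.lean` /
`StretchingNestedTargets.lean`). **Search for candidate a priori estimates; no regularity claim.** Static facts
about smooth divergence-free fields on `T³`; nothing is asserted about Navier–Stokes.

All four nodes are now kernel theorems — N1 `wrapIdentityBound_holds`, N2 `confinementLemma_holds`, N3±
`planarFillerFamilyPotPlus_holds` / `planarFillerFamilyPotMinus_holds`, N4 `plateauEnvelope_holds` — so the
dictionary's assemblies give, unconditionally:
* `confinedPlus_holds`, `confinedMinus_holds` (A1±);
* **`nestedLowerBound_holds : NestedLowerBound`**, i.e. **`nested_le_stretchingSupConst : (2+√5)/8 ≤ C⋆`**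
  (≈ 0.5295, A3) and the one-sided `oneSided_le_stretchingSupConst : (4+3√2)/16 ≤ C⋆` (A2);
* **`half_lt_stretchingSupConst : ½ < C⋆`** and **`stretchingSupConstOn_isTwoHalfD_lt_stretchingSupConst :
  C_{2.5D} < C⋆`** — the optimal constant of the K1-Q1 row `σ ≤ C‖ω‖∞ℰ` over all smooth divergence-free
  fields on `T³` is STRICTLY larger than over the `2½`-dimensional class, where it equals `½`
  (`CellularStretching.stretchingSupConstOn_isTwoHalfD_eq_half`).
Kernel window: `(2+√5)/8 ≤ C⋆ ≤ 2/√3` (`stretchingSupConst_le_holder`).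
-/

noncomputable section

open MeasureTheory Set Filter Topology Function
open scoped InnerProductSpace ContDiff

namespace Summit.NavierStokesRegularity.FunctionalMining

open Literature.Analysis Literature.Analysis.FunctionSpaces Literature.Analysis.FunctionSpaces.Torus
open Literature.Analysis.FluidPDE Literature.Analysis.FluidPDE.Torus

namespace WrapFinal

open CellularStretching Confinement WrapStretching FillerMinus Swap12

/-- **`ConfinedPlus` holds** (A1+ with the kernel proofs of N2, N3+, N4). [ours] -/
theorem confinedPlus_holds : ConfinedPlus :=
  confinedPlus_of_confinement confinementLemma_holds planarFillerFamilyPotPlus_holds plateauEnvelope_holds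

/-- **`ConfinedMinus` holds** (A1− with the kernel proofs of N2, N3−, N4). [ours] -/
theorem confinedMinus_holds : ConfinedMinus :=
  confinedMinus_of_confinement confinementLemma_holds planarFillerFamilyPotMinus_holds plateauEnvelope_holds

/-- **`NestedLowerBound` holds: `(2+√5)/8 ≤ C⋆`** (A3 with N1 and the two confined fillers). [ours] -/
theorem nestedLowerBound_holds : NestedLowerBound :=
  nestedLowerBound_of_wrapIdentity wrapIdentityBound_holds confinedPlus_holds confinedMinus_holds

/-- **K1-Q1, unconditional: `(2+√5)/8 ≤ C⋆`** (≈ 0.5295; bank `K1Q1-HALF.md` Theorem 3, now a kernel theorem).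
Search for candidate a priori estimates; no regularity claim. [ours] -/
theorem nested_le_stretchingSupConst : (2 + Real.sqrt 5) / 8 ≤ stretchingSupConst (d := Fin 3) :=
  nestedLowerBound_holds

/-- **K1-Q1, unconditional: `(4+3√2)/16 ≤ C⋆`** (≈ 0.5152; the one-sided assembly A2). [ours] -/
theorem oneSided_le_stretchingSupConst : (4 + 3 * Real.sqrt 2) / 16 ≤ stretchingSupConst (d := Fin 3) :=
  oneSided_le_stretchingSupConst_of_wrapIdentity wrapIdentityBound_holds confinedPlus_holds

/-- **K1-Q1, unconditional: `½ < C⋆`** — genuinely three-dimensional fields beat the planar optimum. [ours] -/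
theorem half_lt_stretchingSupConst : (1 : ℝ) / 2 < stretchingSupConst (d := Fin 3) :=
  half_lt_oneSided_const.trans_le oneSided_le_stretchingSupConst

/-- **K1-Q1, unconditional: no constant `C < (2+√5)/8` is valid in `σ ≤ C‖ω‖∞ℰ`.** [ours] -/
theorem not_stretchingSupBound_of_lt_nested {C : ℝ} (hC : C < (2 + Real.sqrt 5) / 8) :
    ¬ StretchingSupBound (d := Fin 3) C := fun hB =>
  absurd (hC.trans_le (nested_le_stretchingSupConst.trans (stretchingSupConst_le
    (bddBelow_stretchingSupValid (not_stretchingSupBound_of_lt_half (C := 0) (by norm_num))) hB))) (lt_irrefl C)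

/-- **K1-Q1, unconditional: STRICT SEPARATION `C_{2.5D} < C⋆`** — the optimal constant over `2½`-dimensional
fields (`= ½`, `CellularStretching.stretchingSupConstOn_isTwoHalfD_eq_half`) is strictly smaller than over all
smooth divergence-free fields. Search for candidate a priori estimates; no regularity claim. [ours] -/
theorem stretchingSupConstOn_isTwoHalfD_lt_stretchingSupConst :
    stretchingSupConstOn (IsTwoHalfD (d := Fin 3)) < stretchingSupConst (d := Fin 3) := by
  rw [stretchingSupConstOn_isTwoHalfD_eq_half]
  exact half_lt_stretchingSupConst

/-- **Kernel window for `C⋆` after the wrap blueprint:** `(2+√5)/8 ≤ C⋆ ≤ 2/√3`. [ours] -/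
theorem stretchingSupConst_window_nested :
    (2 + Real.sqrt 5) / 8 ≤ stretchingSupConst (d := Fin 3) ∧ stretchingSupConst (d := Fin 3) ≤ 2 / Real.sqrt 3 :=
  ⟨nested_le_stretchingSupConst, stretchingSupConst_le_holder⟩

end WrapFinal

end Summit.NavierStokesRegularity.FunctionalMining

end
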